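import Mathlib
import HarnessLib
import Literature.Analysis.FluidPDE.TaoCascadeNoLow
import Literature.Analysis.FluidPDE.Tao2016AveragedNS.WeightedLatticeFlows
import Literature.Analysis.FluidPDE.Tao2016AveragedNS.RenormalisedCascadeWaves

/-!
# Route `WakeRatchet`, crux `MinimalViscousBlowup` (stmt-NavierStokesRegularity-22743) — LINE g11-1 «threshold ray» (ns-idea-1 g11), input (E1) of
# STUB-PLAN-regularOpen.md for stub S2 `stub_regularOpen`: the ENERGY-DISSIPATION BUDGET of a global regular viscous solution

For a table of the class `E₂(R)` (cancellation (4.3)), `λ = 1+ε₀ > 1`, `ν > 0` and a GLOBAL REGULAR solution `X` of the NS-scaled `ν`-viscous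
cascade lattice from the one-shell datum `X₀` (`ViscousGlobal ε₀ ν α X₀ X`):
* `hasDerivWithinAt_truncEnergy` — the truncated energy `E_L(t) = Σ_{k<L} Σ_i ½X_{i,k}(t)²` has derivative `−Π_{L−1}(t) − ν Σ_{k<L} λ^{2k}‖X_k(t)‖²`
  within `[0,∞)` (shell energy identity + telescoping of the bond fluxes `Π_k = botSum`; `Π_{−1} = 0` by (4.11));
* `exists_small_dissipation_time` — **(E1)**: for every `θ > 0` there is a time `t₁ ≥ 0` at which the WEIGHT-ONE ENERGY is small on every
  truncation, `Σ_{k<L} λ^{2k} Σ_i X_{i,k}(t₁)² ≤ θ²` for all `L` (energy budget `ν∫Σλ^{2k}‖X_k‖² ≤ E₀ + o(1)`, the flux out of the top shell being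
  uniformly small by the (4.5) decay, plus a uniform tail bound from (4.5)).
MODEL lattice ODEs only; nothing here concerns the Navier–Stokes equations.  `--supports stmt-NavierStokesRegularity-22743 --as helper`.
[cite: Tao2016AveragedNS, §4 proof of (4.13) (energy identity, cancellation (4.3)), Lemma 4.1 (4.5), (4.11)]
-/

noncomputable section

-- the summit and its single sub-problem share the name (CONVENTIONS §1)
set_option linter.dupNamespace false

open Set Filter Topology MeasureTheory

namespace Summit.NavierStokesRegularity.NavierStokesRegularity.Theorems.MinimalViscousBlowup.ThresholdRay

open Literature.Analysis.FluidPDE Literature.Analysis.FluidPDE.TaoCascade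

variable {m : ℕ}

/-! ### §1 The truncated energy identity -/

/-- The bond flux below the datum shell vanishes when there are no shells below `0`. [folklore] -/
theorem botSum_neg_one_eq_zero {ε₀ : ℝ} {α : Fin m → Fin m → Fin m → ℤ × ℤ × ℤ → ℝ} {X : Fin m → ℤ → ℝ → ℝ}
    (hlow : ∀ i k t, k < 0 → 0 ≤ t → X i k t = 0) {t : ℝ} (ht : 0 ≤ t) : botSum ε₀ α X (-1) t = 0 := by
  unfold botSum
  simp [hlow _ (-1) t (by norm_num) ht]

/-- **Truncated energy identity.**  For a cancelling table and a family solving the `ν`-viscous lattice within `[0,∞)` with no shells below `0`,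
`d/dt Σ_{k<L} Σ_i ½X_{i,k}² = −Π_{L−1} − ν Σ_{k<L} λ^{2k} Σ_i X_{i,k}²`. [cite: Tao2016AveragedNS, §4 proof of (4.13)] -/
theorem hasDerivWithinAt_truncEnergy {ε₀ ν : ℝ} {α : Fin m → Fin m → Fin m → ℤ × ℤ × ℤ → ℝ} (hc : IsCancellingCoeff α)
    {X : Fin m → ℤ → ℝ → ℝ} (hlow : ∀ i k t, k < 0 → 0 ≤ t → X i k t = 0)
    (hder : ∀ (i : Fin m) (k : ℤ), ∀ t ∈ Ici (0 : ℝ), HasDerivWithinAt (X i k)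
      (quadTerm ε₀ α X i k t - ν * (1 + ε₀) ^ ((2 : ℝ) * k) * X i k t) (Ici 0) t)
    (L : ℕ) {u : ℝ} (hu : u ∈ Ici (0 : ℝ)) :
    HasDerivWithinAt (fun w => ∑ k ∈ Finset.range L, ∑ i : Fin m, (1 / 2 : ℝ) * X i k w ^ 2)
      (-botSum ε₀ α X ((L : ℤ) - 1) u -
        ν * ∑ k ∈ Finset.range L, (1 + ε₀) ^ ((2 : ℝ) * (k : ℤ)) * ∑ i : Fin m, X i k u ^ 2) (Ici 0) u := by
  -- shell identity
  have hshell : ∀ k : ℤ, HasDerivWithinAt (fun w => ∑ i : Fin m, (1 / 2 : ℝ) * X i k w ^ 2)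
      (botSum ε₀ α X (k - 1) u - botSum ε₀ α X k u - ν * (1 + ε₀) ^ ((2 : ℝ) * k) * ∑ i : Fin m, X i k u ^ 2) (Ici 0) u := by
    intro k
    have h := HasDerivWithinAt.fun_sum (u := Finset.univ)
      fun (i : Fin m) (_ : i ∈ Finset.univ) => ((hder i k u hu).pow 2).const_mul (1 / 2 : ℝ)
    refine h.congr_deriv ?_
    have hsq := sum_quadTerm_mul ε₀ α X k u
    rw [botSum_eq_neg_topSum ε₀ hc X k u]
    calc ∑ i : Fin m, (1 / 2 : ℝ) * (((2 : ℕ) : ℝ) * X i k u ^ (2 - 1) *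
            (quadTerm ε₀ α X i k u - ν * (1 + ε₀) ^ ((2 : ℝ) * k) * X i k u))
        = (∑ i : Fin m, quadTerm ε₀ α X i k u * X i k u) -
            ν * (1 + ε₀) ^ ((2 : ℝ) * k) * ∑ i : Fin m, X i k u ^ 2 := by
          rw [Finset.mul_sum, ← Finset.sum_sub_distrib]
          refine Finset.sum_congr rfl fun i _ => ?_
          push_cast
          ring
      _ = _ := by rw [hsq]; ring
  -- sum over the shells `k < L` and telescope
  have hsum := HasDerivWithinAt.fun_sum (u := Finset.range L) fun (k : ℕ) (_ : k ∈ Finset.range L) => hshell k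
  refine hsum.congr_deriv ?_
  have htel : ∑ k ∈ Finset.range L, (botSum ε₀ α X ((k : ℤ) - 1) u - botSum ε₀ α X k u) =
      botSum ε₀ α X (-1) u - botSum ε₀ α X ((L : ℤ) - 1) u := by
    have := Finset.sum_range_sub' (fun k : ℕ => botSum ε₀ α X ((k : ℤ) - 1) u) L
    simp only [Nat.cast_zero, zero_sub] at this
    rw [← this]
    refine Finset.sum_congr rfl fun k _ => ?_
    push_cast
    ring_nf
  rw [Finset.sum_sub_distrib, htel, botSum_neg_one_eq_zero hlow (show (0 : ℝ) ≤ u from hu), zero_sub, Finset.mul_sum]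
  exact congrArg₂ _ rfl (Finset.sum_congr rfl fun k _ => by ring)

/-! ### §2 (E1): a time of small weight-one energy -/

/-- **(E1) ENERGY-DISSIPATION BUDGET ⇒ a time of small weight-one energy.**  For `ε₀ > 0`, `ν > 0`, a table of the class `E₂(R)` and a global regular
`ν`-viscous solution `X` from the one-shell datum `X₀`: for every `θ > 0` there is `t₁ ≥ 0` with `Σ_{k<L} λ^{2k} Σ_i X_{i,k}(t₁)² ≤ θ²` for every `L`.
[cite: Tao2016AveragedNS, §4 proof of (4.13) and Lemma 4.1 (4.5)] -/
theorem exists_small_dissipation_time {ε₀ ν R : ℝ} (hε : 0 < ε₀) (hν : 0 < ν)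
    {α : Fin m → Fin m → Fin m → ℤ × ℤ × ℤ → ℝ} (hα : InTableClass R α) {X₀ : Fin m → ℝ} {X : Fin m → ℤ → ℝ → ℝ}
    (hX : ViscousGlobal ε₀ ν α X₀ X) {θ : ℝ} (hθ : 0 < θ) :
    ∃ t₁ : ℝ, 0 ≤ t₁ ∧ ∀ L : ℕ, ∑ k ∈ Finset.range L, (1 + ε₀) ^ ((2 : ℝ) * (k : ℤ)) * ∑ i : Fin m, X i k t₁ ^ 2 ≤ θ ^ 2 := by
  have hl0 : (0 : ℝ) < 1 + ε₀ := by linarith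
  have hl1 : (1 : ℝ) < 1 + ε₀ := by linarith
  have hlow : ∀ i k t, k < 0 → 0 ≤ t → X i k t = 0 := hX.noLow
  have hder : ∀ (i : Fin m) (k : ℤ), ∀ t ∈ Ici (0 : ℝ), HasDerivWithinAt (X i k)
      (quadTerm ε₀ α X i k t - ν * (1 + ε₀) ^ ((2 : ℝ) * k) * X i k t) (Ici 0) t := by
    intro i k t ht
    have h := ((hX.contDiffOn i k).differentiableOn one_ne_zero t ht).hasDerivWithinAt
    rwa [hX.motion i k t ht] at h
  have hXc : ∀ i k, ContinuousOn (X i k) (Ici 0) := fun i k => (hX.contDiffOn i k).continuousOn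
  -- powers of `λ`
  set r : ℝ := (1 + ε₀)⁻¹ with hr
  have hr0 : 0 < r := inv_pos.2 hl0
  have hr1 : r < 1 := inv_lt_one_of_one_lt₀ hl1
  have hsplit : ∀ a b : ℝ, (1 + ε₀) ^ a = (1 + ε₀) ^ (a - b) * (1 + ε₀) ^ b := fun a b => by
    rw [← Real.rpow_add hl0]; ring_nf
  have hmono : ∀ a b : ℝ, a ≤ b → (1 + ε₀) ^ a ≤ (1 + ε₀) ^ b := fun a b h =>
    Real.rpow_le_rpow_of_exponent_le hl1.le h
  have hrnat : ∀ j : ℕ, (1 + ε₀) ^ (-(j : ℝ)) = r ^ j := fun j => by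
    rw [Real.rpow_neg hl0.le, Real.rpow_natCast, inv_pow]
  -- the datum energy, the horizon and the (4.5) bound on `[0,T]`
  set E₀ : ℝ := ∑ i : Fin m, (1 / 2 : ℝ) * X₀ i ^ 2 with hE₀
  have hE₀0 : 0 ≤ E₀ := Finset.sum_nonneg fun i _ => by positivity
  set T : ℝ := 2 * (E₀ + 2) / (ν * θ ^ 2) with hT
  have hT0 : 0 < T := by positivity
  obtain ⟨M₀, hM₀⟩ := hX.apriori T hT0
  set M : ℝ := max M₀ 1 with hMdef
  have hM1 : 1 ≤ M := le_max_right _ _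
  have hM0 : 0 ≤ M := zero_le_one.trans hM1
  have hM : ∀ t ∈ Icc (0 : ℝ) T, ∀ (i : Fin m) (k : ℤ), (1 + (1 + ε₀) ^ ((10 : ℝ) * k)) * |X i k t| ≤ M :=
    fun t ht i k => (hM₀ t ht i k).trans (le_max_left _ _)
  have hXle : ∀ t ∈ Icc (0 : ℝ) T, ∀ (i : Fin m) (k : ℤ), |X i k t| ≤ M := by
    intro t ht i k
    have h := hM t ht i k
    have hp : 0 < (1 + ε₀) ^ ((10 : ℝ) * k) := Real.rpow_pos_of_pos hl0 _
    nlinarith [abs_nonneg (X i k t)]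
  have hXdec : ∀ t ∈ Icc (0 : ℝ) T, ∀ (i : Fin m) (k : ℤ), (1 + ε₀) ^ ((10 : ℝ) * k) * |X i k t| ≤ M := by
    intro t ht i k
    have h := hM t ht i k
    nlinarith [abs_nonneg (X i k t)]
  -- (a) weight-one shell energies decay geometrically on `[0,T]`
  have hshell : ∀ t ∈ Icc (0 : ℝ) T, ∀ k : ℕ,
      (1 + ε₀) ^ ((2 : ℝ) * (k : ℤ)) * ∑ i : Fin m, X i k t ^ 2 ≤ (m : ℝ) * M ^ 2 * r ^ k := by
    intro t ht k
    have hk : ∀ i : Fin m, (1 + ε₀) ^ ((2 : ℝ) * (k : ℤ)) * X i k t ^ 2 ≤ M ^ 2 * r ^ k := by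
      intro i
      have h1 := hXdec t ht i k
      have h2 : ((1 + ε₀) ^ ((10 : ℝ) * (k : ℤ)) * |X i k t|) ^ 2 ≤ M ^ 2 :=
        pow_le_pow_left₀ (mul_nonneg (Real.rpow_nonneg hl0.le _) (abs_nonneg _)) h1 2
      have h3 : ((1 + ε₀) ^ ((10 : ℝ) * (k : ℤ)) * |X i k t|) ^ 2 =
          (1 + ε₀) ^ ((20 : ℝ) * (k : ℤ)) * X i k t ^ 2 := by
        rw [mul_pow, sq_abs]
        congr 1
        rw [← Real.rpow_natCast, ← Real.rpow_mul hl0.le]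
        congr 1
        push_cast
        ring
      rw [h3] at h2
      have h4 : (1 + ε₀) ^ ((2 : ℝ) * (k : ℤ) - (20 : ℝ) * (k : ℤ)) ≤ r ^ k := by
        rw [← hrnat k]
        exact hmono _ _ (by push_cast; nlinarith [(Nat.cast_nonneg k : (0 : ℝ) ≤ k)])
      calc (1 + ε₀) ^ ((2 : ℝ) * (k : ℤ)) * X i k t ^ 2
          = (1 + ε₀) ^ ((2 : ℝ) * (k : ℤ) - (20 : ℝ) * (k : ℤ)) *
              ((1 + ε₀) ^ ((20 : ℝ) * (k : ℤ)) * X i k t ^ 2) := by rw [hsplit ((2 : ℝ) * (k : ℤ)) ((20 : ℝ) * (k : ℤ))]; ring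
        _ ≤ r ^ k * M ^ 2 :=
            mul_le_mul h4 h2 (mul_nonneg (Real.rpow_nonneg hl0.le _) (sq_nonneg _)) (pow_nonneg hr0.le _)
        _ = M ^ 2 * r ^ k := mul_comm _ _
    calc (1 + ε₀) ^ ((2 : ℝ) * (k : ℤ)) * ∑ i : Fin m, X i k t ^ 2
        = ∑ i : Fin m, (1 + ε₀) ^ ((2 : ℝ) * (k : ℤ)) * X i k t ^ 2 := Finset.mul_sum _ _ _
      _ ≤ ∑ _i : Fin m, M ^ 2 * r ^ k := Finset.sum_le_sum fun i _ => hk i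
      _ = (m : ℝ) * M ^ 2 * r ^ k := by simp [Finset.sum_const, Finset.card_univ, Fintype.card_fin]; ring
  -- (b) the flux out of the block `k ≤ n` is geometrically small on `[0,T]`
  have hα1 : ∀ i₁ i₂ i₃ : Fin m, |α i₁ i₂ i₃ (0, 0, 1)| ≤ 1 := fun i₁ i₂ i₃ =>
    abs_le_one_of_inTableClass hα i₁ i₂ i₃ _ (by rw [mem_shiftSet_iff]; simp)
  have hflux : ∀ n : ℕ, ∀ t ∈ Icc (0 : ℝ) T, |botSum ε₀ α X n t| ≤ (m : ℝ) ^ 3 * M ^ 3 * r ^ (n + 1) := by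
    intro n t ht
    have hkey : ∀ i₃ : Fin m,
        (1 + ε₀) ^ ((5 : ℝ) * ((n : ℕ) : ℤ) / 2) * |X i₃ (((n : ℕ) : ℤ) + 1) t| ≤ M * r ^ (n + 1) := by
      intro i₃
      have h1 := hXdec t ht i₃ (((n : ℕ) : ℤ) + 1)
      have h4 : (1 + ε₀) ^ ((5 : ℝ) * ((n : ℕ) : ℤ) / 2 - (10 : ℝ) * ((((n : ℕ) : ℤ) + 1 : ℤ) : ℝ)) ≤ r ^ (n + 1) := by
        rw [← hrnat (n + 1)]
        exact hmono _ _ (by push_cast; nlinarith [(Nat.cast_nonneg n : (0 : ℝ) ≤ n)])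
      calc (1 + ε₀) ^ ((5 : ℝ) * ((n : ℕ) : ℤ) / 2) * |X i₃ (((n : ℕ) : ℤ) + 1) t|
          = (1 + ε₀) ^ ((5 : ℝ) * ((n : ℕ) : ℤ) / 2 - (10 : ℝ) * ((((n : ℕ) : ℤ) + 1 : ℤ) : ℝ)) *
              ((1 + ε₀) ^ ((10 : ℝ) * ((((n : ℕ) : ℤ) + 1 : ℤ) : ℝ)) * |X i₃ (((n : ℕ) : ℤ) + 1) t|) := by
            rw [hsplit ((5 : ℝ) * ((n : ℕ) : ℤ) / 2) ((10 : ℝ) * ((((n : ℕ) : ℤ) + 1 : ℤ) : ℝ))]; ring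
        _ ≤ r ^ (n + 1) * M :=
            mul_le_mul h4 h1 (mul_nonneg (Real.rpow_nonneg hl0.le _) (abs_nonneg _)) (pow_nonneg hr0.le _)
        _ = M * r ^ (n + 1) := mul_comm _ _
    have hterm : ∀ i₁ i₂ i₃ : Fin m,
        |α i₁ i₂ i₃ (0, 0, 1) * (1 + ε₀) ^ ((5 : ℝ) * ((n : ℕ) : ℤ) / 2) *
            (X i₁ n t * X i₂ n t * X i₃ (((n : ℕ) : ℤ) + 1) t)| ≤ M * M * (M * r ^ (n + 1)) := by
      intro i₁ i₂ i₃
      rw [abs_mul, abs_mul, abs_mul, abs_mul, abs_of_pos (Real.rpow_pos_of_pos hl0 _)]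
      have hXX : |X i₁ n t| * |X i₂ n t| ≤ M * M :=
        mul_le_mul (hXle t ht i₁ n) (hXle t ht i₂ n) (abs_nonneg _) hM0
      calc |α i₁ i₂ i₃ (0, 0, 1)| * (1 + ε₀) ^ ((5 : ℝ) * ((n : ℕ) : ℤ) / 2) *
            (|X i₁ n t| * |X i₂ n t| * |X i₃ (((n : ℕ) : ℤ) + 1) t|)
          = |α i₁ i₂ i₃ (0, 0, 1)| * (|X i₁ n t| * |X i₂ n t|) *
              ((1 + ε₀) ^ ((5 : ℝ) * ((n : ℕ) : ℤ) / 2) * |X i₃ (((n : ℕ) : ℤ) + 1) t|) := by ring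
        _ ≤ 1 * (M * M) * (M * r ^ (n + 1)) :=
            mul_le_mul (mul_le_mul (hα1 i₁ i₂ i₃) hXX (by positivity) zero_le_one) (hkey i₃)
              (by positivity) (mul_nonneg zero_le_one (mul_nonneg hM0 hM0))
        _ = M * M * (M * r ^ (n + 1)) := by ring
    unfold botSum
    calc |∑ i₁ : Fin m, ∑ i₂ : Fin m, ∑ i₃ : Fin m, α i₁ i₂ i₃ (0, 0, 1) * (1 + ε₀) ^ ((5 : ℝ) * ((n : ℕ) : ℤ) / 2) *
            (X i₁ n t * X i₂ n t * X i₃ (((n : ℕ) : ℤ) + 1) t)|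
        ≤ ∑ i₁ : Fin m, ∑ i₂ : Fin m, ∑ i₃ : Fin m, |α i₁ i₂ i₃ (0, 0, 1) * (1 + ε₀) ^ ((5 : ℝ) * ((n : ℕ) : ℤ) / 2) *
            (X i₁ n t * X i₂ n t * X i₃ (((n : ℕ) : ℤ) + 1) t)| := by
          refine (Finset.abs_sum_le_sum_abs _ _).trans (Finset.sum_le_sum fun i₁ _ => ?_)
          exact (Finset.abs_sum_le_sum_abs _ _).trans (Finset.sum_le_sum fun i₂ _ => Finset.abs_sum_le_sum_abs _ _)
      _ ≤ ∑ _i₁ : Fin m, ∑ _i₂ : Fin m, ∑ _i₃ : Fin m, M * M * (M * r ^ (n + 1)) :=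
          Finset.sum_le_sum fun i₁ _ => Finset.sum_le_sum fun i₂ _ => Finset.sum_le_sum fun i₃ _ => hterm i₁ i₂ i₃
      _ = (m : ℝ) ^ 3 * M ^ 3 * r ^ (n + 1) := by
          simp [Finset.sum_const, Finset.card_univ, Fintype.card_fin]; ring
  -- (c) choice of the truncation `L = n + 1`
  set Φ : ℝ := (m : ℝ) ^ 3 * M ^ 3 with hΦ
  have hΦ0 : 0 ≤ Φ := by positivity
  set Ψ : ℝ := (m : ℝ) * M ^ 2 with hΨ
  have hΨ0 : 0 ≤ Ψ := by positivity
  set δ : ℝ := min (1 / (Φ * T + 1)) (θ ^ 2 / 4 * (1 - r) / (Ψ + 1)) with hδ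
  have hδ0 : 0 < δ := by
    have : 0 < 1 - r := by linarith
    positivity
  obtain ⟨n, hn⟩ := exists_pow_lt_of_lt_one hδ0 hr1
  set L : ℕ := n + 1 with hL
  have hrL : r ^ L ≤ δ := (pow_le_pow_of_le_one hr0.le hr1.le (Nat.le_succ n)).trans hn.le
  have hfluxL : ∀ t ∈ Icc (0 : ℝ) T, |botSum ε₀ α X ((L : ℤ) - 1) t| ≤ 1 / T := by
    intro t ht
    have h1 := hflux n t ht
    have h2 : ((L : ℤ) - 1 : ℤ) = ((n : ℕ) : ℤ) := by rw [hL]; push_cast; ring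
    rw [h2]
    refine h1.trans ?_
    have h3 : Φ * r ^ (n + 1) ≤ Φ * (1 / (Φ * T + 1)) :=
      mul_le_mul_of_nonneg_left (hrL.trans (min_le_left _ _)) hΦ0
    have h4 : Φ * (1 / (Φ * T + 1)) ≤ 1 / T := by
      rw [mul_one_div, div_le_div_iff₀ (by positivity) hT0]
      nlinarith
    exact h3.trans h4
  have htail : ∀ t ∈ Icc (0 : ℝ) T, ∀ L' : ℕ,
      ∑ k ∈ Finset.Ico L L', (1 + ε₀) ^ ((2 : ℝ) * (k : ℤ)) * ∑ i : Fin m, X i k t ^ 2 ≤ θ ^ 2 / 4 := by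
    intro t ht L'
    calc ∑ k ∈ Finset.Ico L L', (1 + ε₀) ^ ((2 : ℝ) * (k : ℤ)) * ∑ i : Fin m, X i k t ^ 2
        ≤ ∑ k ∈ Finset.Ico L L', Ψ * r ^ k := Finset.sum_le_sum fun k _ => hshell t ht k
      _ = Ψ * ∑ k ∈ Finset.Ico L L', r ^ k := (Finset.mul_sum _ _ _).symm
      _ ≤ Ψ * (r ^ L / (1 - r)) := mul_le_mul_of_nonneg_left (geom_sum_Ico_le_of_lt_one hr0.le hr1) hΨ0
      _ ≤ Ψ * (θ ^ 2 / 4 * (1 - r) / (Ψ + 1) / (1 - r)) := by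
          have h1r : 0 < 1 - r := by linarith
          gcongr
          exact hrL.trans (min_le_right _ _)
      _ ≤ θ ^ 2 / 4 := by
          have h1r : (1 : ℝ) - r ≠ 0 := by linarith
          have hΨ1 : Ψ + 1 ≠ 0 := ne_of_gt (by linarith [hΨ0])
          have hfrac : Ψ / (Ψ + 1) ≤ 1 := by rw [div_le_one (by linarith [hΨ0])]; linarith
          have heq : Ψ * (θ ^ 2 / 4 * (1 - r) / (Ψ + 1) / (1 - r)) = θ ^ 2 / 4 * (Ψ / (Ψ + 1)) := by
            field_simp
          rw [heq]
          exact (mul_le_mul_of_nonneg_left hfrac (by positivity)).trans_eq (mul_one _)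
  -- (d) the energy budget on `[0,T]` for the block `k < L`
  set F : ℝ → ℝ := fun w => ∑ k ∈ Finset.range L, ∑ i : Fin m, (1 / 2 : ℝ) * X i k w ^ 2 with hF
  set D : ℝ → ℝ := fun w => ∑ k ∈ Finset.range L, (1 + ε₀) ^ ((2 : ℝ) * (k : ℤ)) * ∑ i : Fin m, X i k w ^ 2 with hD
  have hXcT : ∀ (i : Fin m) (k : ℤ), ContinuousOn (X i k) (Icc 0 T) := fun i k => (hXc i k).mono Icc_subset_Ici_self
  have hFc : ContinuousOn F (Icc 0 T) :=
    continuousOn_finsetSum _ fun k _ => continuousOn_finsetSum _ fun i _ => (continuousOn_const.mul ((hXcT i k).pow 2))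
  have hDc : ContinuousOn D (Icc 0 T) :=
    continuousOn_finsetSum _ fun k _ => continuousOn_const.mul (continuousOn_finsetSum _ fun i _ => (hXcT i k).pow 2)
  have hBc : ContinuousOn (fun w => botSum ε₀ α X ((L : ℤ) - 1) w) (Icc 0 T) := by
    unfold botSum
    refine continuousOn_finsetSum _ fun i₁ _ => continuousOn_finsetSum _ fun i₂ _ =>
      continuousOn_finsetSum _ fun i₃ _ => ?_
    exact (continuousOn_const.mul continuousOn_const).mul (((hXcT _ _).mul (hXcT _ _)).mul (hXcT _ _))
  have hderF : ∀ x ∈ Ioo (0 : ℝ) T, HasDerivWithinAt F (-botSum ε₀ α X ((L : ℤ) - 1) x - ν * D x) (Ioi x) x := by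
    intro x hx
    exact (hasDerivWithinAt_truncEnergy hα.2.1 hlow hder L (show x ∈ Ici (0 : ℝ) from hx.1.le)).mono
      fun y hy => hx.1.le.trans (le_of_lt hy)
  have hint : IntervalIntegrable (fun x => -botSum ε₀ α X ((L : ℤ) - 1) x - ν * D x) volume 0 T :=
    ((hBc.neg).sub (continuousOn_const.mul hDc)).intervalIntegrable_of_Icc hT0.le
  have hFTC := intervalIntegral.integral_eq_sub_of_hasDeriv_right_of_le hT0.le hFc hderF hint
  have hF0 : F 0 = E₀ := by
    simp only [hF]
    rw [Finset.sum_range_succ']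
    have hz : ∀ (i : Fin m) (k : ℕ), X i ((k : ℤ) + 1) 0 = 0 := fun i k => by
      rw [hX.init]; exact if_neg (by omega)
    have h0 : ∀ i : Fin m, X i 0 0 = X₀ i := fun i => by rw [hX.init]; simp
    simp [hz, h0, hE₀]
  have hFT : 0 ≤ F T := Finset.sum_nonneg fun k _ => Finset.sum_nonneg fun i _ => by positivity
  -- (e) a time of small truncated weight-one energy
  obtain ⟨t₁, ht₁, hD₁⟩ : ∃ t₁ ∈ Icc (0 : ℝ) T, D t₁ ≤ θ ^ 2 / 2 := by
    by_contra h
    have h' : ∀ t ∈ Icc (0 : ℝ) T, -botSum ε₀ α X ((L : ℤ) - 1) t - ν * D t ≤ 1 / T - ν * (θ ^ 2 / 2) := by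
      intro t ht
      have h1 : θ ^ 2 / 2 ≤ D t := le_of_lt (not_le.1 fun hle => h ⟨t, ht, hle⟩)
      have h2 := (abs_le.1 (hfluxL t ht)).1
      nlinarith
    have hle := intervalIntegral.integral_mono_on hT0.le hint intervalIntegrable_const h'
    rw [hFTC, intervalIntegral.integral_const, smul_eq_mul, hF0] at hle
    have hTid : ν * (θ ^ 2 / 2) * T = E₀ + 2 := by
      rw [hT]; field_simp
    have hT1 : (T - 0) * (1 / T - ν * (θ ^ 2 / 2)) = 1 - (E₀ + 2) := by
      rw [← hTid]; field_simp; ring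
    rw [hT1] at hle
    linarith
  refine ⟨t₁, ht₁.1, fun L' => ?_⟩
  rcases le_or_gt L' L with hL' | hL'
  · calc ∑ k ∈ Finset.range L', (1 + ε₀) ^ ((2 : ℝ) * (k : ℤ)) * ∑ i : Fin m, X i k t₁ ^ 2
        ≤ D t₁ := Finset.sum_le_sum_of_subset_of_nonneg (Finset.range_mono hL') fun k _ _ =>
            mul_nonneg (Real.rpow_nonneg hl0.le _) (Finset.sum_nonneg fun i _ => sq_nonneg _)
      _ ≤ θ ^ 2 := by nlinarith [sq_nonneg θ]
  · rw [← Finset.sum_range_add_sum_Ico _ hL'.le]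
    have := htail t₁ ht₁ L'
    change D t₁ + _ ≤ _
    nlinarith [sq_nonneg θ]

/-- **(E1), pointwise form.**  At the time `t₁` of `exists_small_dissipation_time` every mode obeys `λ^k |X_{i,k}(t₁)| ≤ θ` (`k ≥ 0`; the modes
below `0` vanish). [cite: Tao2016AveragedNS, §4 proof of (4.13) and Lemma 4.1 (4.5)] -/
theorem exists_small_weightOne_time {ε₀ ν R : ℝ} (hε : 0 < ε₀) (hν : 0 < ν)
    {α : Fin m → Fin m → Fin m → ℤ × ℤ × ℤ → ℝ} (hα : InTableClass R α) {X₀ : Fin m → ℝ} {X : Fin m → ℤ → ℝ → ℝ}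
    (hX : ViscousGlobal ε₀ ν α X₀ X) {θ : ℝ} (hθ : 0 < θ) :
    ∃ t₁ : ℝ, 0 ≤ t₁ ∧ (∀ L : ℕ, ∑ k ∈ Finset.range L, (1 + ε₀) ^ ((2 : ℝ) * (k : ℤ)) * ∑ i : Fin m, X i k t₁ ^ 2 ≤ θ ^ 2) ∧
      ∀ (i : Fin m) (k : ℕ), (1 + ε₀) ^ k * |X i k t₁| ≤ θ := by
  obtain ⟨t₁, ht₁, h⟩ := exists_small_dissipation_time hε hν hα hX hθ
  refine ⟨t₁, ht₁, h, fun i k => ?_⟩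
  have hl0 : (0 : ℝ) < 1 + ε₀ := by linarith
  have h1 := h (k + 1)
  have h2 : (1 + ε₀) ^ ((2 : ℝ) * (k : ℤ)) * X i k t₁ ^ 2 ≤ θ ^ 2 := by
    refine le_trans ?_ h1
    rw [Finset.sum_range_succ]
    have h3 : (1 + ε₀) ^ ((2 : ℝ) * (k : ℤ)) * X i k t₁ ^ 2 ≤
        (1 + ε₀) ^ ((2 : ℝ) * (k : ℤ)) * ∑ j : Fin m, X j k t₁ ^ 2 :=
      mul_le_mul_of_nonneg_left (Finset.single_le_sum (fun j _ => sq_nonneg (X j (k : ℤ) t₁)) (Finset.mem_univ i))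
        (Real.rpow_nonneg hl0.le _)
    have h4 : 0 ≤ ∑ k' ∈ Finset.range k, (1 + ε₀) ^ ((2 : ℝ) * (k' : ℤ)) * ∑ j : Fin m, X j k' t₁ ^ 2 :=
      Finset.sum_nonneg fun k' _ => mul_nonneg (Real.rpow_nonneg hl0.le _) (Finset.sum_nonneg fun j _ => sq_nonneg _)
    linarith
  have h5 : (1 + ε₀) ^ ((2 : ℝ) * (k : ℤ)) = ((1 + ε₀) ^ k) ^ 2 := by
    rw [← Real.rpow_natCast ((1 + ε₀) ^ k) 2, ← Real.rpow_natCast (1 + ε₀) k, ← Real.rpow_mul hl0.le]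
    push_cast
    ring_nf
  rw [h5, ← mul_pow] at h2
  have h6 : ((1 + ε₀) ^ k * |X i k t₁|) ^ 2 ≤ θ ^ 2 := by rwa [mul_pow, sq_abs, ← mul_pow]
  exact (pow_le_pow_iff_left₀ (mul_nonneg (pow_nonneg hl0.le _) (abs_nonneg _)) hθ.le two_ne_zero).1 h6

end Summit.NavierStokesRegularity.NavierStokesRegularity.Theorems.MinimalViscousBlowup.ThresholdRay

end
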